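import Summits.QuantumFields.BalabanUV.T4Continuum.Support.NE7FlatGradientModulusCompact
import HarnessLib

/-!
# NE7FlatGradientHolderCompact — THE FLAT C¹ COMPACT LETTER, HÖLDER-½ FORM: for a flat (`U = 1`) matrix-valued bond field `Z` supported in a cube of radius `R`
# (resp. a block-aligned box of side `P = L^{k+1}·N′`), `‖∇_μZ_κ(x) − ∇_μZ_κ(x′)‖ ≤ C(d)·√((R+1)·h)·(B′ + D′)` (resp. `≤ K(d)·√(P·h)·(B′ + D′)`), `h = |x − x′|_∞`,
# `B′ ≥ sup‖∇(curlAt 1 Z)‖`, `D′ ≥ sup‖∇(flatDiv Z)‖` — the «Hölder-½ companion» of memo ROAD-G106 §4, read off the log-Lipschitz modulus of `NE7FlatGradientModulusCompact`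

Cell `pub-balaban`, rung (B)+1 sub-cell t4; written by the row-NE7b OWNER lineage `b2b-balaban-t4-ne7b-p1` (gen 154) for the sibling crux row NE7 (lineage `t4-ne7-p1`,
gen 106's INTERFACE REQUEST NE7 stub (S-c), `HOME/INBOX.md` [NE7P1-G106-INBOX-2]; memo `t4/b2b-balaban-t4-ne7-p1-g106/ROAD-G106.md` §4: «… and the Hölder-½ (indeed any
β < 1) companion»; AMENDMENT 5's socket `h′` asks (Höl½ᶜ) `‖Ad H_j D(y + j•e_μ) − D(y)‖ ≤ Λ_H·√j·ξ²·√ξ`).  Sequel of `NE7FlatGradientLetterCompact` (part (i)) and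
`NE7FlatGradientModulusCompact` (part (ii)).
THE ARITHMETIC ([folklore]).  `sq_mul_one_add_posLog_le`: for `0 < h ≤ P`, `h·(1 + log⁺(P∕h)) ≤ 2√(P·h)` (`log t ≤ 2(√t − 1)` at `t = P∕h ≥ 1`, as in the tree's
`Literature.Analysis.Fourier.Prop31.log_le_two_mul_sqrt_sub_one` — kept as a local step, that module's olean being off the farm's closure); so on `h ≤ R + 1` part (ii)'s
`C·h·(1 + log⁺((R+1)∕h))` is `≤ 2C·√((R+1)h)`, and on `h > R + 1` the two increments separately are `≤ Cg·(R+1) ≤ Cg·√((R+1)h)` by part (i).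
WHAT (0 def, 0 sorry; every `d ≥ 3`, resp. dimension `d + 1 ≥ 3`; constants existential in `d`).  `sq_mul_one_add_posLog_le`,
**`gradient_holderHalf_cube`**, **`gradient_holderHalf_box`** (hypotheses VERBATIM those of `gradient_modulus_cube` ∕ `gradient_modulus_box`).
HONEST FRAMING (page 1): `U = 1`, linear, flat; bookkeeping over parts (i)(ii); NOT the curved C¹ letter, NOT the (Lip₁ᶜ)(Höl½ᶜ) supplier (no transport, no minimiser here), NOT NE7,
nothing of row NE7b (`T4WeightBudget.RelWeightBound` NOT PRINTED ∕ NOT PROVED); nothing of Bałaban's asserted; spine count = dagwriter∕referees' call; finite T⁴ rung (B)+1 —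
NOT infinite volume, NOT mass gap, NOT BetaPertH, NOT Clay.  Continuum YM on T⁴ ⇐ BetaPertH ∧ nine spine estimates (0/9 proved); BetaPertH ⇐ (D1) ∧ (D4) ∧ CAP+tail;
G-an2-4 gates asym, D1 and NE2/3/4.
-/

set_option autoImplicit false

open scoped BigOperators Matrix.Norms.L2Operator
open Finset

namespace Summit.QuantumFields.BalabanUV.T4Continuum.NE7FlatGradientHolderCompact

open Literature.MathematicalPhysics.QuantumFieldTheory.Balaban1983to89
open B7Prop1Explicit (Site e)
open T4AveragingDeficitWall (curlAt)
open BlockAveragePushDirSplit (flat)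
open NE3CoercivityScaling (flatDiv)
open Beta.PoissonInterior (cube mem_cube cube_mono supNorm supNorm_eq_zero_iff nrm)
open NE7FlatGradientLetterCompact (mem_cube_succ_of_add_e gradient_letter_cube)
open NE7FlatGradientModulusCompact (gradient_modulus_cube)

noncomputable section

variable {d : ℕ} {n : Type*} [Fintype n] [DecidableEq n]

/-! ## §1 `h·(1 + log⁺(P∕h)) ≤ 2√(P·h)` -/

omit [Fintype n] [DecidableEq n] in
/-- **`h·(1 + log⁺(P∕h)) ≤ 2·√(P·h)`** for `0 < h ≤ P`. [folklore] -/
theorem sq_mul_one_add_posLog_le {P h : ℝ} (hh : 0 < h) (hhP : h ≤ P) :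
    h * (1 + Real.posLog (P / h)) ≤ 2 * Real.sqrt (P * h) := by
  have hP : 0 < P := lt_of_lt_of_le hh hhP
  have ht1 : 1 ≤ P / h := by rw [le_div_iff₀ hh, one_mul]; exact hhP
  have ht0 : 0 < P / h := by positivity
  rw [Real.posLog_eq_log (by rw [abs_of_pos ht0]; exact ht1)]
  -- `log t ≤ 2(√t − 1)` at `t = P/h` (the tree's `Literature.Analysis.Fourier.Prop31.log_le_two_mul_sqrt_sub_one`; three lines, kept local)
  have hlog : Real.log (P / h) ≤ 2 * (Real.sqrt (P / h) - 1) := by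
    have hs : 0 < Real.sqrt (P / h) := Real.sqrt_pos.2 ht0
    have h1 : Real.log (Real.sqrt (P / h)) ≤ Real.sqrt (P / h) - 1 := Real.log_le_sub_one_of_pos hs
    have h2 : Real.log (P / h) = 2 * Real.log (Real.sqrt (P / h)) := by
      conv_lhs => rw [← Real.mul_self_sqrt ht0.le]
      rw [Real.log_mul hs.ne' hs.ne']
      ring
    rw [h2]
    linarith
  have hPh : P * h = h ^ 2 * (P / h) := by
    field_simp
  have hsq : h * Real.sqrt (P / h) = Real.sqrt (P * h) := by
    rw [hPh, Real.sqrt_mul (sq_nonneg h), Real.sqrt_sq hh.le]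
  calc h * (1 + Real.log (P / h)) ≤ h * (2 * Real.sqrt (P / h)) := by
        apply mul_le_mul_of_nonneg_left _ hh.le
        linarith
    _ = 2 * Real.sqrt (P * h) := by rw [← hsq]; ring

/-! ## §2 The Hölder-½ letters -/

/-- **THE FLAT C¹ COMPACT LETTER, HÖLDER-½ FORM, CUBE GEOMETRY** (`d ≥ 3`): `∃ C ≥ 0` (a function of `d`) such that for every cube `cube c R`, every bond field `Z`
vanishing off it, every `B′ ≥ 0` bounding `‖curlAt 1 Z (z + e_λ) μ ν − curlAt 1 Z z μ ν‖` (`μ ≠ ν`), every `D′` bounding `‖flatDiv Z (x + e_λ) − flatDiv Z x‖`, and all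
`x, x′, μ, κ` (`h := supNorm (x − x′)`): `‖(Z (x+e_μ) κ − Z x κ) − (Z (x′+e_μ) κ − Z x′ κ)‖ ≤ C·√((R+1)·h)·(B′ + D′)`. [folklore] -/
theorem gradient_holderHalf_cube (hd : 3 ≤ d) : ∃ C : ℝ, 0 ≤ C ∧
    ∀ (c : Site d) (R : ℕ) (Z : Site d → Fin d → Matrix n n ℂ), (∀ x, x ∉ cube c R → Z x = 0) →
      ∀ (B' : ℝ), 0 ≤ B' → (∀ (z : Site d) (lam μ ν : Fin d), μ ≠ ν →
        ‖curlAt (flat (d := d) (n := n)) Z (z + e lam) μ ν - curlAt (flat (d := d) (n := n)) Z z μ ν‖ ≤ B') →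
      ∀ (D' : ℝ), (∀ (x : Site d) (lam : Fin d), ‖flatDiv Z (x + e lam) - flatDiv Z x‖ ≤ D') →
      ∀ (x x' : Site d) (μ κ : Fin d),
        ‖(Z (x + e μ) κ - Z x κ) - (Z (x' + e μ) κ - Z x' κ)‖
          ≤ C * Real.sqrt (((R : ℝ) + 1) * supNorm (x - x')) * (B' + D') := by
  obtain ⟨Cm, hCm, hmod⟩ := gradient_modulus_cube (d := d) (n := n) hd
  obtain ⟨Cg, hCg, hgrad⟩ := gradient_letter_cube (d := d) (n := n) hd
  refine ⟨2 * Cm + 2 * Cg, by positivity, fun c R Z hZ B' hB0 hB D' hD x x' μ κ => ?_⟩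
  have hD0 : 0 ≤ D' := (norm_nonneg _).trans (hD x μ)
  have hBD : 0 ≤ B' + D' := by positivity
  have hR0 : (0 : ℝ) < (R : ℝ) + 1 := by positivity
  rcases Nat.eq_zero_or_pos (supNorm (x - x')) with hh0 | hh1
  · have hxx : x = x' := sub_eq_zero.1 (supNorm_eq_zero_iff.1 hh0)
    rw [hh0]
    subst hxx
    simp
  have hh0r : (0 : ℝ) < supNorm (x - x') := by exact_mod_cast hh1
  have hsq0 : 0 ≤ Real.sqrt (((R : ℝ) + 1) * supNorm (x - x')) := Real.sqrt_nonneg _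
  by_cases hhR : (supNorm (x - x') : ℝ) ≤ (R : ℝ) + 1
  · -- the log-Lipschitz modulus, `h(1 + log⁺((R+1)/h)) ≤ 2√((R+1)h)`
    have key := sq_mul_one_add_posLog_le hh0r hhR
    calc ‖(Z (x + e μ) κ - Z x κ) - (Z (x' + e μ) κ - Z x' κ)‖
        ≤ Cm * (supNorm (x - x') : ℝ) * (1 + Real.posLog (((R : ℝ) + 1) / supNorm (x - x'))) * (B' + D') :=
          hmod c R Z hZ B' hB0 hB D' hD x x' μ κ
      _ = Cm * ((supNorm (x - x') : ℝ) * (1 + Real.posLog (((R : ℝ) + 1) / supNorm (x - x')))) * (B' + D') := by ring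
      _ ≤ Cm * (2 * Real.sqrt (((R : ℝ) + 1) * supNorm (x - x'))) * (B' + D') :=
          mul_le_mul_of_nonneg_right (mul_le_mul_of_nonneg_left key hCm) hBD
      _ ≤ (2 * Cm + 2 * Cg) * Real.sqrt (((R : ℝ) + 1) * supNorm (x - x')) * (B' + D') := by
          apply mul_le_mul_of_nonneg_right _ hBD
          nlinarith [mul_nonneg hCg hsq0]
  · -- `h > R + 1`: the two increments separately, `R + 1 ≤ √((R+1)h)`
    rw [not_le] at hhR
    have hRsq : (R : ℝ) + 1 ≤ Real.sqrt (((R : ℝ) + 1) * supNorm (x - x')) := by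
      rw [Real.le_sqrt hR0.le (by positivity)]
      nlinarith
    have h1 := hgrad c R Z hZ B' hB0 hB D' hD x μ κ
    have h2 := hgrad c R Z hZ B' hB0 hB D' hD x' μ κ
    calc ‖(Z (x + e μ) κ - Z x κ) - (Z (x' + e μ) κ - Z x' κ)‖
        ≤ ‖Z (x + e μ) κ - Z x κ‖ + ‖Z (x' + e μ) κ - Z x' κ‖ := norm_sub_le _ _
      _ ≤ Cg * ((R : ℝ) + 1) * (B' + D') + Cg * ((R : ℝ) + 1) * (B' + D') := add_le_add h1 h2
      _ = 2 * Cg * ((R : ℝ) + 1) * (B' + D') := by ring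
      _ ≤ 2 * Cg * Real.sqrt (((R : ℝ) + 1) * supNorm (x - x')) * (B' + D') :=
          mul_le_mul_of_nonneg_right (mul_le_mul_of_nonneg_left hRsq (by positivity)) hBD
      _ ≤ (2 * Cm + 2 * Cg) * Real.sqrt (((R : ℝ) + 1) * supNorm (x - x')) * (B' + D') := by
          apply mul_le_mul_of_nonneg_right _ hBD
          nlinarith [mul_nonneg hCm hsq0]

/-- **THE FLAT C¹ COMPACT LETTER, HÖLDER-½ FORM, BOX GEOMETRY** (dimension `d + 1 ≥ 3`, every `L ≥ 1`, every `k`; `M = L^{k+1}`, `P = M·N′`): `∃ K ≥ 0` (a function of `d`)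
such that for every block-aligned box `M•c′ + [0, P)^{d+1}` (`N′ ≥ 1`), every bond field `Z` vanishing off the box, every `B′ ≥ 0` bounding
`‖curlAt 1 Z (z + e_λ) μ ν − curlAt 1 Z z μ ν‖` (`μ ≠ ν`), every `D′` bounding `‖flatDiv Z (x + e_λ) − flatDiv Z x‖`, and all `x, x′, μ, κ` (`h := supNorm (x − x′)`):
`‖(Z (x+e_μ) κ − Z x κ) − (Z (x′+e_μ) κ − Z x′ κ)‖ ≤ K·√(P·h)·(B′ + D′)`. [folklore] -/
theorem gradient_holderHalf_box (hd : 2 ≤ d) :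
    ∃ K : ℝ, 0 ≤ K ∧ ∀ (L : ℕ), 1 ≤ L → ∀ (k : ℕ) (c' : Site (d + 1)) (N' : ℕ), 1 ≤ N' →
      ∀ (Z : Site (d + 1) → Fin (d + 1) → Matrix n n ℂ),
      (∀ x : Site (d + 1), (∃ i, ¬ (((L ^ (k + 1) : ℕ) : ℤ) * c' i ≤ x i ∧
          x i < ((L ^ (k + 1) : ℕ) : ℤ) * c' i + ((L ^ (k + 1) : ℕ) : ℤ) * N')) → Z x = 0) →
      ∀ (B' : ℝ), 0 ≤ B' → (∀ (z : Site (d + 1)) (lam μ ν : Fin (d + 1)), μ ≠ ν →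
        ‖curlAt (flat (d := d + 1) (n := n)) Z (z + e lam) μ ν - curlAt (flat (d := d + 1) (n := n)) Z z μ ν‖ ≤ B') →
      ∀ (D' : ℝ), (∀ (x : Site (d + 1)) (lam : Fin (d + 1)), ‖flatDiv Z (x + e lam) - flatDiv Z x‖ ≤ D') →
      ∀ (x x' : Site (d + 1)) (μ κ : Fin (d + 1)),
        ‖(Z (x + e μ) κ - Z x κ) - (Z (x' + e μ) κ - Z x' κ)‖
          ≤ K * Real.sqrt (((L : ℝ) ^ (k + 1) * N') * supNorm (x - x')) * (B' + D') := by
  obtain ⟨C, hC, h⟩ := gradient_holderHalf_cube (d := d + 1) (n := n) (by omega)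
  refine ⟨2 * C, by positivity, fun L hL k c' N' hN' Z hZ B' hB0 hB D' hD x x' μ κ => ?_⟩
  have hD0 : 0 ≤ D' := (norm_nonneg _).trans (hD x μ)
  have hBD : 0 ≤ B' + D' := by positivity
  have hZ' : ∀ y, y ∉ cube (fun i => ((L ^ (k + 1) : ℕ) : ℤ) * c' i) (L ^ (k + 1) * N') → Z y = 0 := by
    intro y hy
    refine hZ y ?_
    by_contra hall
    simp only [not_exists, not_not] at hall
    apply hy
    rw [mem_cube]
    intro i
    obtain ⟨h1, h2⟩ := hall i
    have hN0 : (0 : ℤ) ≤ ((L ^ (k + 1) : ℕ) : ℤ) * N' := by positivity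
    rw [abs_le]
    constructor <;> push_cast at h1 h2 hN0 ⊢ <;> linarith
  have hM1 : 1 ≤ L ^ (k + 1) * N' := Nat.one_le_iff_ne_zero.mpr (Nat.mul_ne_zero (pow_ne_zero _ (by omega)) (by omega))
  have hR1 : (1 : ℝ) ≤ ((L ^ (k + 1) * N' : ℕ) : ℝ) := by exact_mod_cast hM1
  have hRr : ((L ^ (k + 1) * N' : ℕ) : ℝ) = (L : ℝ) ^ (k + 1) * N' := by push_cast; ring
  have hh0 : (0 : ℝ) ≤ supNorm (x - x') := by positivity
  have hmain := h _ _ Z hZ' B' hB0 hB D' hD x x' μ κ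
  -- `√((P+1)h) ≤ √(2Ph) ≤ 2√(Ph)`
  have hsqrt : Real.sqrt ((((L ^ (k + 1) * N' : ℕ) : ℝ) + 1) * supNorm (x - x')) ≤ 2 * Real.sqrt (((L : ℝ) ^ (k + 1) * N') * supNorm (x - x')) := by
    rw [← hRr]
    have h4 : (2 : ℝ) = Real.sqrt 4 := by rw [show (4 : ℝ) = 2 ^ 2 by norm_num, Real.sqrt_sq (by norm_num)]
    rw [h4, ← Real.sqrt_mul (by norm_num)]
    apply Real.sqrt_le_sqrt
    nlinarith
  calc ‖(Z (x + e μ) κ - Z x κ) - (Z (x' + e μ) κ - Z x' κ)‖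
      ≤ C * Real.sqrt ((((L ^ (k + 1) * N' : ℕ) : ℝ) + 1) * supNorm (x - x')) * (B' + D') := hmain
    _ ≤ C * (2 * Real.sqrt (((L : ℝ) ^ (k + 1) * N') * supNorm (x - x'))) * (B' + D') :=
        mul_le_mul_of_nonneg_right (mul_le_mul_of_nonneg_left hsqrt hC) hBD
    _ = 2 * C * Real.sqrt (((L : ℝ) ^ (k + 1) * N') * supNorm (x - x')) * (B' + D') := by ring

end

end Summit.QuantumFields.BalabanUV.T4Continuum.NE7FlatGradientHolderCompact
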